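/-
Copyright (c) 2026. All rights reserved.
Released under Apache 2.0 license as described in the file LICENSE.
-/
import Summits.Langlands.Langlands.Theorems.SoloInformedBmaxPlusSpecialisation
import Summits.Langlands.Langlands.Theorems.SoloInformedWittIntegralRange
import Literature.NumberTheory.PAdicHodge.BdRPeriodRingData
import Literature.NumberTheory.PAdicHodge.BmaxPlusTransportedLegendre
import HarnessLib

/-!
# `(A_max)^{Γ_F} = W(k̄)^{Γ_F}`: the Galois invariants of `B_max⁺(F)`

Solo/informed seat, programme Λ (statement repair D2-cris, input (I2) `B_max(F)^{Γ_F} = F₀`), file Λ2 — the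
untwisted integral layer, PROVED:

  **`specC_main` (`forall_galBmaxPlus_iff`).** For `x ∈ A_max = B_max⁺(F)`:
  `(∀ σ ∈ Γ_F, σ x = x) ↔ ∃ z ∈ W(k̄), (∀ σ, W(σ̄) z = z) ∧ x = ι z`,
  where `k̄ = 𝒪_{F^un}/𝔪` is the residue field of the maximal unramified extension, `ι : W(k̄) → 𝔸_inf(F) → A_max`
  (`wittToAinf`, `ainfToBmaxPlus`) and `σ̄ = residueGal σ`.

Proof (§3), with `λ : A_max → W(k_C)` the unramified specialisation of `SoloInformedBmaxPlusSpecialisation` and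
`j : k̄ ↪ k_C = 𝒪_{ℂ_F}/𝔪_C`:
1. (§2) a `Γ_F`-invariant `x` is, inside `B_dR(F)`, an element of `B_dR^{Γ_F} = F` (tree `fixedPoints_fracBdR_eq_range`),
   hence a root of a nonzero `P ∈ ℤ_p[X]` (`F/ℚ_p` algebraic, `PadicBase.instIsAlgebraic`; denominators cleared by
   `IsLocalization.integerNormalization`; pulled back along the injection `B_max⁺ ↪ B_dR⁺`, tree `bmaxPlusToBdR_injective`);
2. `λ x ∈ W(k_C)` is then a root of `W(j)(P) ≠ 0`, so `λ x = W(j) z` with `z ∈ W(k̄)` (Λ0,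
   `WittIntegralRange.mem_range_map_of_eval_eq_zero_of_isAlgClosed`), and `z` is `Γ_F`-invariant because `λ` is
   equivariant and `W(j)` is injective;
3. `y = x − ι z` is `Γ_F`-invariant with `λ y = 0`; by step 1 `yᵏ Q(y) = 0` with `Q(0) ∈ ℤ_p ∖ 0`; `A_max` is a domain
   (it embeds in `B_dR⁺`), and `Q(y) = 0` would give `λ(Q(y)) = Q(0) = 0` in `W(k_C) ⊇ ℤ_p`; so `y = 0`.

§1 supplies the `ℤ_p`-structures `ℤ_p = W(𝔽_p) → W(k)` and their compatibility with `λ`, `ι`, `W(j)`.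

References: Fontaine, Astérisque 223 (1994), Exp. II §1.5, Exp. III §§1.5, 4.1; Colmez, Ann. of Math. 148 (1998),
§III.2 (`A_max ∩ B_dR^{Γ} = W(k_F)`); Serre, Local Fields, Ch. II §§5–6.
-/

noncomputable section

open WittVector Field IsLocalRing ValuativeRel Polynomial
open Literature.AlgebraicGeometry.Resolution
open Literature.NumberTheory.GaloisRepresentations Literature.NumberTheory.PAdicHodge
open Literature.NumberTheory.GaloisRepresentations.IsNonarchimedeanLocalField

namespace Summit.Langlands.Langlands.Theorems

namespace SpecC

/-! ### §1 `ℤ_p = W(𝔽_p) → W(k)` -/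

section Zp

variable {p : ℕ} [Fact p.Prime]

variable (p) in
/-- **`ℤ_p = W(𝔽_p) → W(k)`** for a ring `k` of characteristic `p` (Witt functoriality along `𝔽_p → k` after
Mathlib's `W(𝔽_p) ≃ ℤ_p`; for `k = 𝒪_{ℂ_F}♭` this is the tree's `zpToAinf`). [cite: SerreLocalFields1979, Ch. II §6] -/
def zpToWitt (k : Type*) [CommRing k] [CharP k p] : ℤ_[p] →+* WittVector p k :=
  (WittVector.map (ZMod.castHom (dvd_refl p) k)).comp (WittVector.equiv p).symm.toRingHom

/-- **Uniqueness: `W(f) ∘ (ℤ_p → W(k)) = (ℤ_p → W(k'))`** for every `f : k → k'` (`𝔽_p → k'` is unique).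
[cite: SerreLocalFields1979, Ch. II §6] -/
theorem map_comp_zpToWitt {k k' : Type*} [CommRing k] [CharP k p] [CommRing k'] [CharP k' p] (f : k →+* k') :
    (WittVector.map f).comp (zpToWitt p k) = zpToWitt p k' := by
  have hc : f.comp (ZMod.castHom (dvd_refl p) k) = ZMod.castHom (dvd_refl p) k' := Subsingleton.elim _ _
  refine RingHom.ext fun a => ?_
  simp only [zpToWitt, RingHom.comp_apply]
  refine WittVector.ext fun n => ?_
  rw [WittVector.map_coeff, WittVector.map_coeff, WittVector.map_coeff]
  exact RingHom.congr_fun hc _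

/-- Pointwise form of `map_comp_zpToWitt`. [folklore] -/
theorem map_zpToWitt {k k' : Type*} [CommRing k] [CharP k p] [CommRing k'] [CharP k' p] (f : k →+* k') (a : ℤ_[p]) :
    WittVector.map f (zpToWitt p k a) = zpToWitt p k' a := by
  rw [← RingHom.comp_apply, map_comp_zpToWitt]

/-- **`ℤ_p → W(k)` is injective** for `k` nontrivial of characteristic `p`. [cite: SerreLocalFields1979, Ch. II §6] -/
theorem zpToWitt_injective (k : Type*) [CommRing k] [CharP k p] [Nontrivial k] : Function.Injective (zpToWitt p k) :=
  (WittVector.map_injective _ (ZMod.castHom (dvd_refl p) k).injective).comp (WittVector.equiv p).symm.injective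

/-- `Polynomial.map` along `ℤ_p → W(k)` detects `0`. [folklore] -/
theorem map_zpToWitt_ne_zero (k : Type*) [CommRing k] [CharP k p] [Nontrivial k] {P : ℤ_[p][X]} (hP : P ≠ 0) :
    P.map (zpToWitt p k) ≠ 0 :=
  (Polynomial.map_ne_zero_iff (zpToWitt_injective k)).2 hP

/-- **`P = Xᵏ · Q` with `Q(0) ≠ 0`** for a nonzero polynomial. [folklore] -/
theorem exists_eq_X_pow_mul_coeff_zero_ne_zero {R : Type*} [CommRing R] [Nontrivial R] {P : R[X]} (hP : P ≠ 0) :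
    ∃ k : ℕ, ∃ Q : R[X], P = X ^ k * Q ∧ Q.coeff 0 ≠ 0 := by
  induction h : P.natDegree using Nat.strong_induction_on generalizing P with
  | _ n ih =>
    by_cases h0 : P.coeff 0 = 0
    · obtain ⟨Q, rfl⟩ := Polynomial.X_dvd_iff.2 h0
      have hQ : Q ≠ 0 := by rintro rfl; exact hP (mul_zero _)
      have hlt : Q.natDegree < n := by rw [← h, Polynomial.natDegree_X_mul hQ]; exact Nat.lt_succ_self _
      obtain ⟨k, Q', rfl, hQ'⟩ := ih _ hlt hQ rfl
      exact ⟨k + 1, Q', by rw [pow_succ', mul_assoc], hQ'⟩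
    · exact ⟨0, P, by rw [pow_zero, one_mul], h0⟩

end Zp

variable {F : Type} [Field F] [ValuativeRel F] [TopologicalSpace F] [IsNonarchimedeanLocalField F] [CharZero F]
  {p : ℕ} [Fact p.Prime] [Fact (¬ IsUnit (p : integerC F))] [IsAdicComplete (Ideal.span {(p : integerC F)}) (integerC F)]
  [CharP (ResidueField (integerC F)) p]

omit [CharZero F] [IsAdicComplete (Ideal.span {(p : integerC F)}) (integerC F)] in
/-- **`W(π) ∘ (ℤ_p → 𝔸_inf) = (ℤ_p → W(k_C))`.** [folklore] -/
theorem ainfResidue_zpToAinf (a : ℤ_[p]) :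
    ainfResidue F p (zpToAinf a : Ainf (p := p) F) = zpToWitt p (ResidueField (integerC F)) a := by
  have hc : (tiltResidue F p).comp (ZMod.castHom (dvd_refl p) (PreTilt (integerC F) p)) =
      ZMod.castHom (dvd_refl p) (ResidueField (integerC F)) := Subsingleton.elim _ _
  simp only [zpToAinf, zpToWitt, RingHom.comp_apply]
  refine WittVector.ext fun n => ?_
  rw [coeff_ainfResidue, WittVector.map_coeff, WittVector.map_coeff]
  exact RingHom.congr_fun hc _

omit [IsAdicComplete (Ideal.span {(p : integerC F)}) (integerC F)] in
/-- **`λ ∘ (ℤ_p → A_max) = (ℤ_p → W(k_C))`**: `λ` is the identity on the `ℤ_p`-scalars. [folklore] -/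
theorem specBmaxPlus_comp_zpToAinf :
    (specBmaxPlus F p).comp ((ainfToBmaxPlus F p).comp zpToAinf) = zpToWitt p (ResidueField (integerC F)) :=
  RingHom.ext fun a => by
    rw [RingHom.comp_apply, RingHom.comp_apply, specBmaxPlus_ainfToBmaxPlus, ainfResidue_zpToAinf]

/-! ### §2 `Γ_F`-invariants of `A_max` are algebraic over `ℤ_p` -/

omit [CharP (ResidueField (integerC F)) p] in
set_option maxHeartbeats 1600000 in
/-- **A `Γ_F`-invariant element of `A_max = B_max⁺(F)` is a root of a nonzero polynomial over `ℤ_p`** (its image in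
`B_dR(F)` lies in `B_dR^{Γ_F} = F`, which is algebraic over `ℚ_p`; the relation is pulled back along the injection
`B_max⁺ ↪ B_dR⁺`). [cite: FontaineAsterisque223III, Exp. II §1.5.7, Exp. III §1.5] [cite: Colmez1998Annals, §III.2] -/
theorem exists_polynomial_of_forall_galBmaxPlus (hp : valuation F p < 1) {x : BmaxPlus F p}
    (hx : ∀ σ : absoluteGaloisGroup F, galBmaxPlus σ x = x) :
    ∃ P : ℤ_[p][X], P ≠ 0 ∧ (P.map ((ainfToBmaxPlus F p).comp zpToAinf)).eval x = 0 := by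
  have hF : Function.Surjective (fontaineTheta (integerC F) p) := surjective_fontaineTheta_integerC hp
  haveI := isDomain_bDeRhamPlus (F := F) (p := p) hF
  -- (1) the image of `x` in `B_dR` is `Γ_F`-invariant, hence in `F`
  have hX : algebraMap (BDeRhamPlus (integerC F) p) (FracBdR F p) (bmaxPlusToBdR F p x) ∈
      {y : FracBdR F p | ∀ σ : absoluteGaloisGroup F, σ • y = y} := by
    intro σ
    rw [smul_algebraMap_fracBdR, galBdRPlus_bmaxPlusToBdR, hx σ]
  rw [fixedPoints_fracBdR_eq_range hp hF] at hX
  obtain ⟨c, hc⟩ := hX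
  have hc' : embBdRHom hp hF c = bmaxPlusToBdR F p x := algebraMap_fracBdR_injective hc
  -- (2) `c` is algebraic over `K₀ = ℚ_p`
  obtain ⟨P, hP0, hPc⟩ := Algebra.IsAlgebraic.isAlgebraic (R := PadicBase F p hp) c
  have h1 : (P.map ((PadicBase.toPadic hp : PadicBase F p hp →+* ℚ_[p]))).eval₂
      (qpToBdR : ℚ_[p] →+* BDeRhamPlus (integerC F) p) (bmaxPlusToBdR F p x) = 0 := by
    have h2 : (qpToBdR : ℚ_[p] →+* BDeRhamPlus (integerC F) p).comp
        (PadicBase.toPadic hp : PadicBase F p hp →+* ℚ_[p]) = (embBdRHom hp hF).comp (algebraMap (PadicBase F p hp) F) :=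
      RingHom.ext fun a => (embBdRHom_algebraMap hp hF a).symm
    rw [Polynomial.eval₂_map, h2, ← hc', ← Polynomial.hom_eval₂, ← Polynomial.aeval_def, hPc, map_zero]
  have hPq : P.map ((PadicBase.toPadic hp : PadicBase F p hp →+* ℚ_[p])) ≠ 0 :=
    (Polynomial.map_ne_zero_iff (PadicBase.toPadic hp).injective).2 hP0
  -- (3) clear denominators and pull back to `B_max⁺`
  refine ⟨IsLocalization.integerNormalization (nonZeroDivisors ℤ_[p]) (P.map ((PadicBase.toPadic hp : PadicBase F p hp →+* ℚ_[p]))),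
    fun h => hPq (IsFractionRing.integerNormalization_eq_zero_iff.1 h), ?_⟩
  have h3 := IsLocalization.integerNormalization_eval₂_eq_zero (nonZeroDivisors ℤ_[p])
    (qpToBdR : ℚ_[p] →+* BDeRhamPlus (integerC F) p) _ h1
  have h4 : (bmaxPlusToBdR F p).comp ((ainfToBmaxPlus F p).comp zpToAinf) =
      (qpToBdR : ℚ_[p] →+* BDeRhamPlus (integerC F) p).comp (algebraMap ℤ_[p] ℚ_[p]) :=
    RingHom.ext fun a => by
      rw [RingHom.comp_apply, RingHom.comp_apply, RingHom.comp_apply, bmaxPlusToBdR_ainfToBmaxPlus_zpToAinf,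
        PadicInt.algebraMap_apply]
  apply bmaxPlusToBdR_injective hF
  rw [map_zero, Polynomial.eval_map, Polynomial.hom_eval₂, h4]
  exact h3

omit [IsAdicComplete (Ideal.span {(p : integerC F)}) (integerC F)] in
/-- **`λ` of a root of `P ∈ ℤ_p[X]` is a root of `P` in `W(k_C)`.** [folklore] -/
theorem eval₂_zpToWitt_specBmaxPlus_eq_zero {P : ℤ_[p][X]} {x : BmaxPlus F p}
    (h : (P.map ((ainfToBmaxPlus F p).comp zpToAinf)).eval x = 0) :
    P.eval₂ (zpToWitt p (ResidueField (integerC F))) (specBmaxPlus F p x) = 0 := by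
  have h' := congrArg (specBmaxPlus F p) h
  rwa [map_zero, Polynomial.eval_map, Polynomial.hom_eval₂, specBmaxPlus_comp_zpToAinf] at h'

omit [CharP (ResidueField (integerC F)) p] in
/-- **`A_max = B_max⁺(F)` has no zero divisors** (it embeds in the domain `B_dR⁺(F)`). [cite: Colmez1998Annals, §III.2] -/
theorem noZeroDivisors_bmaxPlus (hp : valuation F p < 1) : NoZeroDivisors (BmaxPlus F p) :=
  haveI := isDomain_bDeRhamPlus (F := F) (p := p) (surjective_fontaineTheta_integerC hp)
  (bmaxPlusToBdR_injective (surjective_fontaineTheta_integerC hp)).noZeroDivisors _ (map_zero _) (map_mul _)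

/-! ### §3 The Galois invariants of `A_max` -/

section Main

variable [Fact (¬ IsUnit (p : maxUnramifiedCompletion F))] [CharP (ResidueField (maxUnramifiedCompletion F)) p]

omit [CharP (ResidueField (integerC F)) p] in
/-- **`ι(W(k̄)^{Γ_F}) ⊆ (A_max)^{Γ_F}`**: `σ(ι z) = ι(W(σ̄) z)`. [cite: FontaineAsterisque223III, Exp. II §1.2] -/
theorem galBmaxPlus_ainfToBmaxPlus_wittToAinf (σ : absoluteGaloisGroup F)
    (z : WittVector p (ResidueField (maxUnramifiedCompletion F))) :
    galBmaxPlus σ (ainfToBmaxPlus F p (wittToAinf F p z)) =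
      ainfToBmaxPlus F p (wittToAinf F p (WittVector.map (residueGal σ) z)) := by
  rw [galBmaxPlus_ainfToBmaxPlus, galAinf_wittToAinf]

set_option maxHeartbeats 1600000 in
/-- **`(A_max)^{Γ_F} ⊆ ι(W(k̄)^{Γ_F})`** — the Galois invariants of `B_max⁺(F)` are unramified Witt vectors:
every `Γ_F`-invariant `x ∈ A_max` is `ι z` for a (unique) `Γ_F`-invariant `z ∈ W(k̄)`. [cite: Colmez1998Annals, §III.2]
[cite: FontaineAsterisque223III, Exp. III §4.1] -/
theorem exists_eq_wittToAinf_of_forall_galBmaxPlus (hp : valuation F p < 1) {x : BmaxPlus F p}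
    (hx : ∀ σ : absoluteGaloisGroup F, galBmaxPlus σ x = x) :
    ∃ z : WittVector p (ResidueField (maxUnramifiedCompletion F)),
      (∀ σ : absoluteGaloisGroup F, WittVector.map (residueGal σ) z = z) ∧ x = ainfToBmaxPlus F p (wittToAinf F p z) := by
  haveI : PerfectRing (ResidueField (maxUnramifiedCompletion F)) p := perfectRing_residueField_completion
  haveI := noZeroDivisors_bmaxPlus (F := F) (p := p) hp
  -- (1)+(2): `λ x` is a root of `W(j)(P)`, `P ≠ 0`, hence `λ x = W(j) z`
  obtain ⟨P, hP0, hP⟩ := exists_polynomial_of_forall_galBmaxPlus hp hx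
  have h1 : ((P.map (zpToWitt p (ResidueField (maxUnramifiedCompletion F)))).map
      (WittVector.map (residueToResidueC F p))).eval (specBmaxPlus F p x) = 0 := by
    rw [Polynomial.eval_map, Polynomial.eval₂_map, map_comp_zpToWitt]
    exact eval₂_zpToWitt_specBmaxPlus_eq_zero hP
  obtain ⟨z, hz⟩ := WittIntegralRange.mem_range_map_of_eval_eq_zero_of_isAlgClosed (residueToResidueC F p)
    (map_zpToWitt_ne_zero _ hP0) h1
  -- `z` is `Γ_F`-invariant
  have hzσ : ∀ σ : absoluteGaloisGroup F, WittVector.map (residueGal σ) z = z := fun σ =>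
    map_residueGal_eq_self_of_map σ (by rw [hz, map_galResidueC_specBmaxPlus_of_forall x hx σ])
  refine ⟨z, hzσ, ?_⟩
  -- (3): `y = x - ι z` is invariant with `λ y = 0`
  set y := x - ainfToBmaxPlus F p (wittToAinf F p z) with hy_def
  have hy : ∀ σ : absoluteGaloisGroup F, galBmaxPlus σ y = y := fun σ => by
    rw [hy_def, map_sub, galBmaxPlus_ainfToBmaxPlus_wittToAinf, hzσ σ, hx σ]
  have hly : specBmaxPlus F p y = 0 := by
    rw [hy_def, map_sub, specBmaxPlus_ainfToBmaxPlus_wittToAinf, hz, sub_self]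
  obtain ⟨Q, hQ0, hQ⟩ := exists_polynomial_of_forall_galBmaxPlus hp hy
  obtain ⟨k, R, rfl, hR⟩ := exists_eq_X_pow_mul_coeff_zero_ne_zero hQ0
  rw [Polynomial.map_mul, Polynomial.map_pow, Polynomial.map_X, eval_mul, eval_pow, eval_X, mul_eq_zero] at hQ
  rcases hQ with hQ | hQ
  · exact sub_eq_zero.1 (eq_zero_of_pow_eq_zero hQ)
  · exfalso
    have h2 := eval₂_zpToWitt_specBmaxPlus_eq_zero hQ
    rw [hly, Polynomial.eval₂_at_zero] at h2
    exact hR (zpToWitt_injective (ResidueField (integerC F)) (by rw [h2, map_zero]))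

/-- ★ **`(A_max)^{Γ_F} = ι(W(k̄)^{Γ_F})`** — the untwisted integral layer of `B_max(F)^{Γ_F} = F₀`: an element of
`A_max = B_max⁺(F)` is `Γ_F`-invariant iff it is the image of a `Γ_F`-invariant Witt vector over the residue field
`k̄` of `F^un` (i.e. of an element of `W(k_F) = 𝒪_{F₀}`). [cite: Colmez1998Annals, §III.2] [cite: FontaineAsterisque223III, Exp. III §4.1] -/
theorem forall_galBmaxPlus_iff (hp : valuation F p < 1) (x : BmaxPlus F p) :
    (∀ σ : absoluteGaloisGroup F, galBmaxPlus σ x = x) ↔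
      ∃ z : WittVector p (ResidueField (maxUnramifiedCompletion F)),
        (∀ σ : absoluteGaloisGroup F, WittVector.map (residueGal σ) z = z) ∧ x = ainfToBmaxPlus F p (wittToAinf F p z) := by
  refine ⟨exists_eq_wittToAinf_of_forall_galBmaxPlus hp, ?_⟩
  rintro ⟨z, hz, rfl⟩ σ
  rw [galBmaxPlus_ainfToBmaxPlus_wittToAinf, hz σ]

omit [IsAdicComplete (Ideal.span {(p : integerC F)}) (integerC F)] in
/-- **Uniqueness of the Witt vector**: `ι : W(k̄) → A_max` is injective (apply `λ`: `λ ∘ ι = W(j)` is injective). [folklore] -/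
theorem ainfToBmaxPlus_wittToAinf_injective :
    Function.Injective fun z : WittVector p (ResidueField (maxUnramifiedCompletion F)) => ainfToBmaxPlus F p (wittToAinf F p z) :=
  fun z₁ z₂ h => map_residueToResidueC_injective (by
    rw [← specBmaxPlus_ainfToBmaxPlus_wittToAinf, ← specBmaxPlus_ainfToBmaxPlus_wittToAinf]
    exact congrArg (specBmaxPlus F p) h)

end Main

end SpecC

end Summit.Langlands.Langlands.Theorems

end
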